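import Summits.BirchSwinnertonDyer.BirchSwinnertonDyer.Theorems.PrintCf2RamifiedOffTYZSquareSilenceStabiliser
import Summits.BirchSwinnertonDyer.BirchSwinnertonDyer.Theorems.PrintCf2RamifiedOffTYZSquareSilenceTwoABC
import HarnessLib

/-!
# Crux `PrintCf2.RamifiedOffTYZOfFacts` (stmt-BirchSwinnertonDyer-20509), line `offtyz-v7`, LEAD cycle 14 (cruxlead-20509 g13):
# THE LOWER HALF OF C⁺ ON THE CELL `n = 2abc`, `a ≡ b ≡ c ≡ 3 (mod 8)`, CYCLIC LEGENDRE TOURNAMENT (`(b/a) = (c/b) = (a/c) = 1`) — type `(3,3,3)`, `s = 3`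

THEOREMS ONLY (no `def`, no named fact, no `sorry`), `--supports stmt-BirchSwinnertonDyer-20509` (C⁺ = item 23431; the `k = 3` even residual type
`(3,3,3)` of g12's census, 21 of the 95 even `k = 3` members `≤ 45000` with `s ≥ 2`; `s(2abc) = 3` for `a ≡ b ≡ c ≡ 3 (mod 8)` iff the Legendre tournament is
a `3`-cycle — crux workfile `Lines/offtyz_v7_RegimeFreeLaw.md`).  This is the GENUS-REGIME type: `g(n)` odd, the top character `χ_n ≢ 0`, so NO witness
exists and g12's coefficient-aware silence (p735302) does not apply; the regime-free block law says `χ_n(g) = [g moves √(abc)]`, which vanishes on the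
stabiliser of `i, √−2, √−n`.  The file proves exactly that, witness-free and regime-free, from the Frobenius rows alone:
* §1 `sqChi_eq_zero_of_neg_neg_three_cycle`: for `g` fixing `i, √−2, √−n` with `g(√−a) = −√−a`, `g(√−b) = −√−b`, the element `g·φ_aφ_c` fixes
  `i, √−2, √−b, √−c, √−n` (Euler symbols of the cycle; the own radical `√−c` of `φ_c` by sign tracking through `√−(2a)`, `√−(2ab)`, `√−n`), hence is
  trivial on `L_n(i)`, and `χ_n(g) = χ_n(φ_a) + χ_n(φ_c) = 0` (`χ_n` additive on `Gal(ℍ′_n/K_n)`, zero on involutions);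
* §2 `sqChi_eq_zero_three_cycle_of_stab`: all of `Stab(i, √−2, √−n)` (the three sign patterns are the three rotations of §1, the cycle is rotation
  invariant);
* §3 the cell theorem through `SquareSilenceStabiliser.two_dvd_scriptL_of_stabiliser_even_of_x_not_mem` (proper blocks `2a, 2b, 2c` free, no block
  `≡ 5`: g12's `TwoABC.divisors_two_abc`), display shape and `OfFacts` shape `two_dvd_scriptL_three_cycle_of_facts`.
BSD is not proved by any of this; no class is closed by this file.

References: [cite: TianYuanZhang2017, Thm. 3.5 (p0011 L94–L100), Lemma 3.18, §3.1 (p0011 L53–L73), Prop. 3.2 (2), Thm. 3.6 (2), proof of Lemma 3.21 (p0020 L27–L63)];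
[cite: Cox2013, §1 (1.13)–(1.15), §5.C Lemma 5.19, (5.22), §9.A]; [cite: HeathBrown1994SelmerCongruentII, Appendix (Monsky)]; [cite: Darmon2004, Thm. 3.22].
-/

noncomputable section

open scoped Classical

open WeierstrassCurve WeierstrassCurve.Affine Finset Literature.NumberTheory.EllipticCurves
  Literature.NumberTheory.EllipticCurves.TianYuanZhang2017
  Literature.NumberTheory.EllipticCurves.TianYuanZhang2017.W2
  Summit.BirchSwinnertonDyer.Rank1Residual.P2.GenusPeriodTransferLayer
  Summit.BirchSwinnertonDyer.Rank1Residual.P2.ThetaDescent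
  Summit.BirchSwinnertonDyer.Rank1Residual.P2
  Summit.BirchSwinnertonDyer.PrintCf2.MoverAssembly
  Summit.BirchSwinnertonDyer.PrintCf2.SquareSilenceEven
  Summit.BirchSwinnertonDyer.PrintCf2.SquareSilenceWitnesses
  Summit.BirchSwinnertonDyer.PrintCf2.FrobeniusPairWitness
  Summit.BirchSwinnertonDyer.PrintCf2.TwoRPQFive
  Summit.BirchSwinnertonDyer.PrintCf2.TwoABC
  Summit.BirchSwinnertonDyer.PrintCf2.SquareSilenceStabiliser

set_option autoImplicit false

namespace Summit.BirchSwinnertonDyer.PrintCf2.ThreeCycle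

variable {n : ℕ} (D : GenusPointData n)

/-! ## §1 One sign pattern: `g` negates `√−a`, `√−b` and fixes `√−c` -/

/-- **The top character vanishes at a stabiliser element negating `√−a`, `√−b`** on the cyclic cell: `n = 2abc`, `a ≡ b ≡ c ≡ 3 (mod 8)`,
`(b/a) = (c/b) = (a/c) = 1`; `g` fixes `i`, `√−2`, `√−c`, `√−n` and negates `√−a`, `√−b`; `φ_a`, `φ_c` the displayed Frobenius elements ((F1)–(F3)) of the
top block.  Then `(g·g)^{g(n)}σ_n⁻¹ ∉ Gal(ℍ′_n/H′_n)`: `g·φ_a·φ_c` is trivial on `L_n(i)` and `χ_n` is additive, zero on `φ_a`, `φ_c`.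
[cite: TianYuanZhang2017, §3.1 (p0011 L1–L13, L60–L66), Prop. 3.2 (2), proof of Lemma 3.21 (p0020 L55–L62)] [cite: Cox2013, §5.C (5.22), §1 (1.13)–(1.15)] -/
theorem sqChi_eq_zero_of_neg_neg_three_cycle (hsq : Squarefree n) {a b c : ℕ} (ha : a.Prime) (hb : b.Prime) (hc : c.Prime)
    (hn : n = 2 * a * b * c) (ha8 : a % 8 = 3) (hb8 : b % 8 = 3) (hc8 : c % 8 = 3)
    (hba : jacobiSym (b : ℤ) a = 1) (hcb : jacobiSym (c : ℤ) b = 1) (hac : jacobiSym (a : ℤ) c = 1)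
    {z : APoint D.H} {Φ : Finset (D.H ≃ₐ[ℚ] D.H)} {ΓH ΓH' : Subgroup (D.H ≃ₐ[ℚ] D.H)} {σ cc : D.H ≃ₐ[ℚ] D.H}
    (hCM : D.CMBlockSpec n z Φ ΓH ΓH' σ cc)
    {φa φc : D.H ≃ₐ[ℚ] D.H}
    (haK : φa (D.sqrtNeg n) = D.sqrtNeg n) (haa : φa * φa ∈ ΓH') (hai : φa D.im = (jacobiSym (-1) a) • D.im)
    (har : ∀ r : ℕ, r.Prime → r ∣ n → r ≠ a → φa (D.sqrtNeg r) = (jacobiSym (-(r : ℤ)) a) • D.sqrtNeg r)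
    (hcK : φc (D.sqrtNeg n) = D.sqrtNeg n) (hcc : φc * φc ∈ ΓH') (hci : φc D.im = (jacobiSym (-1) c) • D.im)
    (hcr : ∀ r : ℕ, r.Prime → r ∣ n → r ≠ c → φc (D.sqrtNeg r) = (jacobiSym (-(r : ℤ)) c) • D.sqrtNeg r)
    {g : D.H ≃ₐ[ℚ] D.H} (hgi : g D.im = D.im) (hg2 : g (D.sqrtNeg 2) = D.sqrtNeg 2) (hgK : g (D.sqrtNeg n) = D.sqrtNeg n)
    (hga : g (D.sqrtNeg a) = -D.sqrtNeg a) (hgb : g (D.sqrtNeg b) = -D.sqrtNeg b) (hgc : g (D.sqrtNeg c) = D.sqrtNeg c) :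
    (g * g) ^ gK n * σ⁻¹ ∉ ΓH' := by
  have hn0 : n ≠ 0 := hsq.ne_zero
  have hnn : n ∈ n.divisors := Nat.mem_divisors_self n hn0
  have hm : ∀ {d : ℕ}, d ∣ n → d ∈ n.divisors := fun hd => Nat.mem_divisors.mpr ⟨hd, hn0⟩
  have ha2 : a ≠ 2 := by omega
  have hc2 : c ≠ 2 := by omega
  have ha4 : a % 4 = 3 := by omega
  have hb4 : b % 4 = 3 := by omega
  have hc4 : c % 4 = 3 := by omega
  have hab : a ≠ b := by
    rintro rfl; exact ha.one_lt.ne' (Nat.isUnit_iff.mp (hsq a ⟨2 * c, by rw [hn]; ring⟩))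
  have hac' : a ≠ c := by
    rintro rfl; exact ha.one_lt.ne' (Nat.isUnit_iff.mp (hsq a ⟨2 * b, by rw [hn]; ring⟩))
  have hbc : b ≠ c := by
    rintro rfl; exact hb.one_lt.ne' (Nat.isUnit_iff.mp (hsq b ⟨2 * a, by rw [hn]; ring⟩))
  have hao : Odd a := ha.odd_of_ne_two ha2
  have hbo : Odd b := hb.odd_of_ne_two (by omega)
  have hco : Odd c := hc.odd_of_ne_two hc2
  -- divisibility
  have d2 : 2 ∣ n := ⟨a * b * c, by rw [hn]; ring⟩
  have hn1 : 1 < n := Nat.lt_of_lt_of_le one_lt_two (Nat.le_of_dvd (Nat.pos_of_ne_zero hn0) d2)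
  have da : a ∣ n := ⟨2 * b * c, by rw [hn]; ring⟩
  have db : b ∣ n := ⟨2 * a * c, by rw [hn]; ring⟩
  have dc : c ∣ n := ⟨2 * a * b, by rw [hn]; ring⟩
  have d2a : 2 * a ∣ n := ⟨b * c, by rw [hn]; ring⟩
  have d2ab : 2 * a * b ∣ n := ⟨c, by rw [hn]⟩
  have hn' : 2 * a * b * c ∈ n.divisors := by rw [← hn]; exact hnn
  -- Jacobi values
  have vᵢa : jacobiSym (-1) a = -1 := by rw [jacobiSym.at_neg_one hao, ZMod.χ₄_nat_three_mod_four ha4]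
  have vᵢc : jacobiSym (-1) c = -1 := by rw [jacobiSym.at_neg_one hco, ZMod.χ₄_nat_three_mod_four hc4]
  have hχ : ∀ m : ℕ, Odd m → jacobiSym (-2) m = if m % 8 = 1 ∨ m % 8 = 3 then 1 else -1 := fun m hmo => by
    rw [jacobiSym.at_neg_two hmo, ZMod.χ₈'_nat_eq_if_mod_eight, if_neg (by rw [Nat.odd_iff] at hmo; omega)]
  have v2a : jacobiSym (-2) a = 1 := by rw [hχ a hao, if_pos (Or.inr ha8)]
  have v2c : jacobiSym (-2) c = 1 := by rw [hχ c hco, if_pos (Or.inr hc8)]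
  -- the cycle read through reciprocity: `(a/b) = -1`, `(c/a) = -1`, `(b/c) = -1`
  have hca : jacobiSym (c : ℤ) a = -1 := by rw [jacobiSym.quadratic_reciprocity_three_mod_four hc4 ha4, hac]
  have hbc' : jacobiSym (b : ℤ) c = -1 := by rw [jacobiSym.quadratic_reciprocity_three_mod_four hb4 hc4, hcb]
  have vba : jacobiSym (-(b : ℤ)) a = -1 := by rw [neg_eq_neg_one_mul, jacobiSym.mul_left, vᵢa, hba]; norm_num
  have vca : jacobiSym (-(c : ℤ)) a = 1 := by rw [neg_eq_neg_one_mul, jacobiSym.mul_left, vᵢa, hca]; norm_num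
  have vac : jacobiSym (-(a : ℤ)) c = -1 := by rw [neg_eq_neg_one_mul, jacobiSym.mul_left, vᵢc, hac]; norm_num
  have vbc : jacobiSym (-(b : ℤ)) c = 1 := by rw [neg_eq_neg_one_mul, jacobiSym.mul_left, vᵢc, hbc']; norm_num
  -- actions of `φ_a`
  have ai : φa D.im = (-1 : ℤ) • D.im := by rw [hai, vᵢa]
  have a2 : φa (D.sqrtNeg 2) = (1 : ℤ) • D.sqrtNeg 2 := by
    rw [har 2 Nat.prime_two d2 ha2.symm, show (-((2 : ℕ) : ℤ)) = -2 by norm_num, v2a]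
  have ab : φa (D.sqrtNeg b) = (-1 : ℤ) • D.sqrtNeg b := by rw [har b hb db hab.symm, vba]
  have acr : φa (D.sqrtNeg c) = (1 : ℤ) • D.sqrtNeg c := by rw [har c hc dc hac'.symm, vca]
  -- actions of `φ_c`, own radical included
  have ci : φc D.im = (-1 : ℤ) • D.im := by rw [hci, vᵢc]
  have c2 : φc (D.sqrtNeg 2) = (1 : ℤ) • D.sqrtNeg 2 := by
    rw [hcr 2 Nat.prime_two d2 hc2.symm, show (-((2 : ℕ) : ℤ)) = -2 by norm_num, v2c]
  have ca : φc (D.sqrtNeg a) = (-1 : ℤ) • D.sqrtNeg a := by rw [hcr a ha da hac', vac]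
  have cb : φc (D.sqrtNeg b) = (1 : ℤ) • D.sqrtNeg b := by rw [hcr b hb db hbc, vbc]
  have c2a : φc (D.sqrtNeg (2 * a)) = (1 : ℤ) • D.sqrtNeg (2 * a) := by
    have h := TwoABC.apply_sqrtNeg_mul_smul D (hm d2) (hm da) (hm d2a) (Or.inr rfl) ci c2 ca
    rwa [show (-1 : ℤ) * 1 * -1 = 1 by ring] at h
  have c2ab : φc (D.sqrtNeg (2 * a * b)) = (-1 : ℤ) • D.sqrtNeg (2 * a * b) := by
    have h := TwoABC.apply_sqrtNeg_mul_smul D (hm d2a) (hm db) (hm d2ab) (Or.inr rfl) ci c2a cb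
    rwa [show (-1 : ℤ) * 1 * 1 = -1 by ring] at h
  have cK' : φc (D.sqrtNeg (2 * a * b * c)) = (1 : ℤ) • D.sqrtNeg (2 * a * b * c) := by rw [one_zsmul, ← hn]; exact hcK
  have ccr : φc (D.sqrtNeg c) = (1 : ℤ) • D.sqrtNeg c := by
    have h := TwoABC.apply_sqrtNeg_smul_of_mul D (hm d2ab) (hm dc) hn' (Or.inr rfl) ci c2ab cK'
    rwa [show (-1 : ℤ) * -1 * 1 = 1 by ring] at h
  -- `t = g · (φ_a φ_c)` fixes `i, √−2, √−b, √−c, √−n`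
  have ti : (g * (φa * φc)) D.im = D.im := by
    rw [AlgEquiv.mul_apply, AlgEquiv.mul_apply, ci, map_zsmul, ai, smul_smul, map_zsmul, hgi]; norm_num
  have t2 : (g * (φa * φc)) (D.sqrtNeg 2) = D.sqrtNeg 2 := by
    rw [AlgEquiv.mul_apply, AlgEquiv.mul_apply, c2, one_zsmul, a2, one_zsmul, hg2]
  have tb : (g * (φa * φc)) (D.sqrtNeg b) = D.sqrtNeg b := by
    rw [AlgEquiv.mul_apply, AlgEquiv.mul_apply, cb, one_zsmul, ab, map_zsmul, hgb]; simp
  have tc : (g * (φa * φc)) (D.sqrtNeg c) = D.sqrtNeg c := by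
    rw [AlgEquiv.mul_apply, AlgEquiv.mul_apply, ccr, one_zsmul, acr, one_zsmul, hgc]
  have tK : (g * (φa * φc)) (D.sqrtNeg n) = D.sqrtNeg n := by
    rw [AlgEquiv.mul_apply, AlgEquiv.mul_apply, hcK, haK, hgK]
  have htL : D.TrivialOnL n (g * (φa * φc)) := by
    refine TwoRPQFive.trivialOnL_of_fix_primes_ne D hsq dvd_rfl ha da ti tK fun p hp hpn hne => ?_
    rcases TwoRPQFive.prime_dvd_two_rpq ha hb hc hp (by rw [← hn]; exact hpn) with rfl | rfl | rfl | rfl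
    · exact t2
    · exact absurd rfl hne
    · exact tb
    · exact tc
  -- additivity of `χ_n`
  have hgKm : g ∈ D.galK n := (D.mem_galK_iff n g).mpr hgK
  have hφaK : φa ∈ D.galK n := (D.mem_galK_iff n _).mpr haK
  have hφcK : φc ∈ D.galK n := (D.mem_galK_iff n _).mpr hcK
  have hψK : (φa * φc) (D.sqrtNeg n) = D.sqrtNeg n := by rw [AlgEquiv.mul_apply, hcK, haK]
  have h0t : ¬ (((g * (φa * φc)) * (g * (φa * φc))) ^ gK n * σ⁻¹ ∈ ΓH') :=
    chi_eq_zero_of_trivialOnL_of_cmBlockSpec D hn1 hCM htL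
  have h0a : ¬ ((φa * φa) ^ gK n * σ⁻¹ ∈ ΓH') := chi_eq_zero_of_mul_self_mem_of_cmBlockSpec D hCM haa
  have h0c : ¬ ((φc * φc) ^ gK n * σ⁻¹ ∈ ΓH') := chi_eq_zero_of_mul_self_mem_of_cmBlockSpec D hCM hcc
  have hadd1 := chi_mul_of_cmBlockSpec D hnn hn1 hCM hgK hψK
  have hadd2 := chi_mul_of_cmBlockSpec D hnn hn1 hCM haK hcK
  rw [if_neg h0t, if_neg h0a, if_neg h0c, add_zero] at *
  rw [hadd2, add_zero] at hadd1
  intro hbad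
  rw [if_pos hbad] at hadd1
  exact zero_ne_one hadd1

/-! ## §2 The whole stabiliser of `i, √−2, √−n` (the three rotations of §1) -/

/-- **The top character of the cyclic cell vanishes on `Stab(i, √−2, √−n)`**: `n = 2abc`, `a ≡ b ≡ c ≡ 3 (mod 8)`, `(b/a) = (c/b) = (a/c) = 1`; the
CM-point display and the conductor-`4` Frobenius clause of the top block; `g` fixing `i`, `√−2`, `√−n`.  Then `(g·g)^{g(n)}σ_n⁻¹ ∉ Gal(ℍ′_n/H′_n)`.
(`g` acts on `√−a, √−b, √−c` by signs with product `+1`; the pattern `(+,+,+)` is `L_n(i)`-trivial, the other three are the rotations of §1 — the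
`3`-cycle is rotation invariant.)  [cite: TianYuanZhang2017, §3.1 (p0011 L1–L13, L60–L66), Prop. 3.2 (2), proof of Lemma 3.21 (p0020 L55–L62)] -/
theorem sqChi_eq_zero_three_cycle_of_stab (hsq : Squarefree n) {a b c : ℕ} (ha : a.Prime) (hb : b.Prime) (hc : c.Prime)
    (hn : n = 2 * a * b * c) (ha8 : a % 8 = 3) (hb8 : b % 8 = 3) (hc8 : c % 8 = 3)
    (hba : jacobiSym (b : ℤ) a = 1) (hcb : jacobiSym (c : ℤ) b = 1) (hac : jacobiSym (a : ℤ) c = 1)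
    {z : APoint D.H} {Φ : Finset (D.H ≃ₐ[ℚ] D.H)} {ΓH ΓH' : Subgroup (D.H ≃ₐ[ℚ] D.H)} {σ cc : D.H ≃ₐ[ℚ] D.H}
    (hCM : D.CMBlockSpec n z Φ ΓH ΓH' σ cc)
    (hF : ∀ q : ℕ, q.Prime → q ∣ n → q ≠ 2 → ∃ φ : D.H ≃ₐ[ℚ] D.H,
      φ (D.sqrtNeg n) = D.sqrtNeg n ∧ φ * φ ∈ ΓH' ∧ φ D.im = (jacobiSym (-1) q) • D.im ∧
        ∀ r : ℕ, r.Prime → r ∣ n → r ≠ q → φ (D.sqrtNeg r) = (jacobiSym (-(r : ℤ)) q) • D.sqrtNeg r)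
    {g : D.H ≃ₐ[ℚ] D.H} (hgi : g D.im = D.im) (hg2 : g (D.sqrtNeg 2) = D.sqrtNeg 2) (hgK : g (D.sqrtNeg n) = D.sqrtNeg n) :
    (g * g) ^ gK n * σ⁻¹ ∉ ΓH' := by
  have hn0 : n ≠ 0 := hsq.ne_zero
  have hm : ∀ {d : ℕ}, d ∣ n → d ∈ n.divisors := fun hd => Nat.mem_divisors.mpr ⟨hd, hn0⟩
  have d2 : 2 ∣ n := ⟨a * b * c, by rw [hn]; ring⟩
  have hn1 : 1 < n := Nat.lt_of_lt_of_le one_lt_two (Nat.le_of_dvd (Nat.pos_of_ne_zero hn0) d2)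
  have da : a ∣ n := ⟨2 * b * c, by rw [hn]; ring⟩
  have db : b ∣ n := ⟨2 * a * c, by rw [hn]; ring⟩
  have dc : c ∣ n := ⟨2 * a * b, by rw [hn]; ring⟩
  have d2a : 2 * a ∣ n := ⟨b * c, by rw [hn]; ring⟩
  have d2ab : 2 * a * b ∣ n := ⟨c, by rw [hn]⟩
  obtain ⟨φa, haK, haa, hai, har⟩ := hF a ha da (by omega)
  obtain ⟨φb, hbK, hbb, hbi, hbr⟩ := hF b hb db (by omega)
  obtain ⟨φc, hcK, hcc, hci, hcr⟩ := hF c hc dc (by omega)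
  -- the product of the three signs of `g` is `+1`
  have hgi' : g D.im = (1 : ℤ) • D.im := by rw [one_zsmul]; exact hgi
  have hg2' : g (D.sqrtNeg 2) = (1 : ℤ) • D.sqrtNeg 2 := by rw [one_zsmul]; exact hg2
  have hprod : ∀ sa sb sc : ℤ, g (D.sqrtNeg a) = sa • D.sqrtNeg a → g (D.sqrtNeg b) = sb • D.sqrtNeg b →
      g (D.sqrtNeg c) = sc • D.sqrtNeg c → D.sqrtNeg n = (sa * sb * sc) • D.sqrtNeg n := by
    intro sa sb sc hsa hsb hsc
    have h2a := TwoABC.apply_sqrtNeg_mul_smul D (hm d2) (hm da) (hm d2a) (Or.inl rfl) hgi' hg2' hsa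
    have h2ab := TwoABC.apply_sqrtNeg_mul_smul D (hm d2a) (hm db) (hm d2ab) (Or.inl rfl) hgi' h2a hsb
    have hK := TwoABC.apply_sqrtNeg_mul_smul D (hm d2ab) (hm dc) (by rw [← hn]; exact hm dvd_rfl) (Or.inl rfl) hgi' h2ab hsc
    rw [← hn, hgK] at hK
    rw [show sa * sb * sc = 1 * (1 * (1 * 1 * sa) * sb) * sc by ring]
    exact hK
  have hbad : ¬ (D.sqrtNeg n = -D.sqrtNeg n) := fun h => D.sqrtNeg_ne_zero (hm dvd_rfl) (eq_zero_of_eq_neg' h)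
  have hpos : ∀ {x : D.H}, g x = x → g x = (1 : ℤ) • x := fun h => by rw [one_zsmul]; exact h
  have hneg : ∀ {x : D.H}, g x = -x → g x = (-1 : ℤ) • x := fun h => by rw [neg_one_zsmul]; exact h
  rcases apply_sqrtNeg_eq_or D g (hm da) with hga | hga <;> rcases apply_sqrtNeg_eq_or D g (hm db) with hgb | hgb <;>
    rcases apply_sqrtNeg_eq_or D g (hm dc) with hgc | hgc
  · -- (+,+,+): trivial on `L_n(i)`
    have hL : D.TrivialOnL n g := by
      refine TwoRPQFive.trivialOnL_of_fix_primes D hn0 dvd_rfl hgi fun p hp hpn => ?_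
      rcases TwoRPQFive.prime_dvd_two_rpq ha hb hc hp (by rw [← hn]; exact hpn) with rfl | rfl | rfl | rfl
      · exact hg2
      · exact hga
      · exact hgb
      · exact hgc
    exact chi_eq_zero_of_trivialOnL_of_cmBlockSpec D hn1 hCM hL
  · -- (+,+,−): impossible
    exact absurd (by have h := hprod _ _ _ (hpos hga) (hpos hgb) (hneg hgc); norm_num at h; exact h) hbad
  · -- (+,−,+): impossible
    exact absurd (by have h := hprod _ _ _ (hpos hga) (hneg hgb) (hpos hgc); norm_num at h; exact h) hbad
  · -- (+,−,−): rotation `(b, c, a)`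
    exact sqChi_eq_zero_of_neg_neg_three_cycle D hsq hb hc ha (by rw [hn]; ring) hb8 hc8 ha8 hcb hac hba hCM
      hbK hbb hbi hbr haK haa hai har hgi hg2 hgK hgb hgc hga
  · -- (−,+,+): impossible
    exact absurd (by have h := hprod _ _ _ (hneg hga) (hpos hgb) (hpos hgc); norm_num at h; exact h) hbad
  · -- (−,+,−): rotation `(c, a, b)`
    exact sqChi_eq_zero_of_neg_neg_three_cycle D hsq hc ha hb (by rw [hn]; ring) hc8 ha8 hb8 hac hba hcb hCM
      hcK hcc hci hcr hbK hbb hbi hbr hgi hg2 hgK hgc hga hgb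
  · -- (−,−,+): §1
    exact sqChi_eq_zero_of_neg_neg_three_cycle D hsq ha hb hc hn ha8 hb8 hc8 hba hcb hac hCM
      haK haa hai har hcK hcc hci hcr hgi hg2 hgK hga hgb hgc
  · -- (−,−,−): impossible
    exact absurd (by have h := hprod _ _ _ (hneg hga) (hneg hgb) (hneg hgc); norm_num at h; exact h) hbad

/-! ## §3 The cell theorem -/

/-- **THE LOWER HALF OF C⁺ ON THE CYCLIC CELL `n = 2abc`, `a ≡ b ≡ c ≡ 3 (mod 8)`, `(b/a) = (c/b) = (a/c) = 1`** (type `(3,3,3)`, `s(n) = 3`),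
display shape over `D.Printed ∧ D.CMPointRingClassFrobeniusValuePrinted`: the top character vanishes on the stabiliser (§2), the proper even blocks
`2a, 2b, 2c` are free, no block is `≡ 5 (mod 8)` (g12's `TwoABC.divisors_two_abc`); then `SquareSilenceStabiliser.two_dvd_scriptL_of_stabiliser_even_of_x_not_mem`.
[cite: TianYuanZhang2017, Thm. 1.1, Thm. 3.5, Lemma 3.18, §3.1, Prop. 3.2 (2), Thm. 3.6 (2), proof of Lemma 3.21] [cite: Cox2013, §5.C, §9.A] [cite: Darmon2004, Thm. 3.22] -/
theorem two_dvd_scriptL_three_cycle_of_valuePrinted (hGZK : rank_eq_analyticRank_of_analyticRank_le_one)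
    (hsq : Squarefree n) {a b c : ℕ} (ha : a.Prime) (hb : b.Prime) (hc : c.Prime) (hn : n = 2 * a * b * c)
    (ha8 : a % 8 = 3) (hb8 : b % 8 = 3) (hc8 : c % 8 = 3)
    (hba : jacobiSym (b : ℤ) a = 1) (hcb : jacobiSym (c : ℤ) b = 1) (hac : jacobiSym (a : ℤ) c = 1)
    (hra : haveI := isElliptic_congruentNumberCurve hsq.ne_zero; (congruentNumberCurve n).analyticRank = 1)
    (D : GenusPointData n) (hPr : D.Printed) (hV : D.CMPointRingClassFrobeniusValuePrinted)
    {x y : ℚ} (hxy : (congruentNumberCurve n).toAffine.Nonsingular x y)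
    (hgen : haveI := isElliptic_congruentNumberCurve hsq.ne_zero;
      ∀ P, ∃ k : ℤ, IsOfFinAddOrder (P - k • (Point.some x y hxy : (congruentNumberCurve n).toAffine.Point)))
    (hx : ¬ ∃ r : ℚ, x = r ^ 2 ∨ x = -r ^ 2 ∨ x = n * r ^ 2 ∨ x = -(n * r ^ 2))
    (hx2 : ¬ ∃ r : ℚ, x = 2 * r ^ 2 ∨ x = -(2 * r ^ 2) ∨ x = 2 * n * r ^ 2 ∨ x = -(2 * n * r ^ 2)) :
    ∀ L : ℤ, IsScriptL n L → (2 : ℤ) ∣ L := by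
  have hn0 : n ≠ 0 := hsq.ne_zero
  have hnn : n ∈ n.divisors := Nat.mem_divisors_self n hn0
  have ha4 : a % 4 = 3 := by omega
  have hab8 : b % 8 = a % 8 := by omega
  have hac8 : c % 8 = a % 8 := by omega
  have hbc8 : (b * c) % 8 = 1 := by
    have h1 := Nat.mul_mod b c 8
    rw [hb8, hc8] at h1; omega
  have h6 : n % 8 = 6 := by
    rw [hn, show 2 * a * b * c = (2 * a) * (b * c) by ring, Nat.mul_mod, hbc8, Nat.mul_mod 2 a]; omega
  have hdvdn : ∀ {d : ℕ}, d ∈ n.divisors → d ∣ 2 * a * b * c := fun hd => hn ▸ Nat.dvd_of_mem_divisors hd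
  have hdvd_of_rec : ∀ {d d' : ℕ}, d' ∈ recursionIndex d → d' ∣ d := fun hd' =>
    Nat.dvd_of_mem_divisors (Finset.mem_filter.mp hd').1
  obtain ⟨hLs, -, hrec, -, h35, -, -, -, h318, -, -⟩ := hPr
  obtain ⟨z, Φ, ΓH, ΓH', σ, θ, cc, ρ₂, ρ₄, hcc, hbl⟩ := hV
  refine SquareSilenceStabiliser.two_dvd_scriptL_of_stabiliser_even_of_x_not_mem D hGZK hsq h6 hra hrec h35 hLs h318 z Φ ΓH ΓH' σ cc hcc
    (fun d hd => ⟨(hbl d hd).1, (hbl d hd).2.2.1⟩) (fun g hgi hg2 hgK => ?_) (fun d hd hd6 hdn => ?_)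
    (fun d hd d' hd' hd'5 => ?_) (fun d hd _ d' hd' e he he5 => ?_) hxy hgen hx hx2
  · -- the top character on the stabiliser
    exact sqChi_eq_zero_three_cycle_of_stab D hsq ha hb hc hn ha8 hb8 hc8 hba hcb hac ((hbl n hnn).1 (Or.inr h6))
      ((hbl n hnn).2.2.2.2.2.2.1 h6) hgi hg2 hgK
  · -- proper even blocks `2a`, `2b`, `2c`
    rcases (TwoABC.divisors_two_abc ha hb hc ha4 hab8 hac8 (hdvdn hd)).2 hd6 with rfl | rfl | rfl | rfl
    · exact Or.inl ⟨a, ha, rfl⟩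
    · exact Or.inl ⟨b, hb, rfl⟩
    · exact Or.inl ⟨c, hc, rfl⟩
    · exact absurd hn.symm hdn
  · -- no block `≡ 5 (mod 8)` at level two
    exact absurd hd'5 (TwoABC.divisors_two_abc ha hb hc ha4 hab8 hac8
      (((hdvd_of_rec hd').trans (hdvd_of_rec hd)).trans (hn ▸ dvd_rfl))).1
  · -- nor at level three
    exact absurd he5 (TwoABC.divisors_two_abc ha hb hc ha4 hab8 hac8
      ((((hdvd_of_rec he).trans (hdvd_of_rec hd')).trans (hdvd_of_rec hd)).trans (hn ▸ dvd_rfl))).1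

/-- **THE LOWER HALF ON THE CYCLIC CELL FROM THE NAMED FACTS** (`OfFacts` shape, by-name closable):
`(tyz_cmPointRingClassFrobeniusValueData ∧ thm11_parity_of_scriptL ∧ GZK)` implies — for primes `a ≡ b ≡ c ≡ 3 (mod 8)` with `(b/a) = (c/b) = (a/c) = 1`,
`n = 2abc` square-free, `ord_{s=1} L(E_n, s) = 1`, and a generator `R = (x, y)` of `E_n(ℚ)` modulo torsion with `x ∉ {±1, ±2, ±n, ±2n}·ℚ^{×2}` —
`2 ∣ L` whenever `𝓛(n)² = L²`.  (`thm11_parity_of_scriptL` is carried for uniformity with the sibling cells; this cell does not use it.)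
[cite: TianYuanZhang2017, Thm. 1.1, §1, §3, Prop. 3.2 (2)] [cite: Cox2013, §5.C, §9.A] [cite: HeathBrown1994SelmerCongruentII, §1] [cite: Darmon2004, Thm. 3.22] -/
theorem two_dvd_scriptL_three_cycle_of_facts :
    (tyz_cmPointRingClassFrobeniusValueData ∧ thm11_parity_of_scriptL ∧ rank_eq_analyticRank_of_analyticRank_le_one) →
      ∀ n a b c : ℕ, (hsq : Squarefree n) → a.Prime → b.Prime → c.Prime → n = 2 * a * b * c → a % 8 = 3 → b % 8 = 3 → c % 8 = 3 →
        jacobiSym (b : ℤ) a = 1 → jacobiSym (c : ℤ) b = 1 → jacobiSym (a : ℤ) c = 1 →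
        (haveI := isElliptic_congruentNumberCurve hsq.ne_zero; (congruentNumberCurve n).analyticRank = 1) →
        ∀ (x y : ℚ) (hxy : (congruentNumberCurve n).toAffine.Nonsingular x y),
          (haveI := isElliptic_congruentNumberCurve hsq.ne_zero;
            ∀ P, ∃ k : ℤ, IsOfFinAddOrder (P - k • (Point.some x y hxy : (congruentNumberCurve n).toAffine.Point))) →
          (¬ ∃ r : ℚ, x = r ^ 2 ∨ x = -r ^ 2 ∨ x = n * r ^ 2 ∨ x = -(n * r ^ 2)) →
          (¬ ∃ r : ℚ, x = 2 * r ^ 2 ∨ x = -(2 * r ^ 2) ∨ x = 2 * n * r ^ 2 ∨ x = -(2 * n * r ^ 2)) →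
            ∀ L : ℤ, IsScriptL n L → (2 : ℤ) ∣ L := by
  intro h n a b c hsq ha hb hc hn ha8 hb8 hc8 hba hcb hac hra x y hxy hgen hx hx2
  have hbc8 : (b * c) % 8 = 1 := by
    have h1 := Nat.mul_mod b c 8
    rw [hb8, hc8] at h1; omega
  have h6 : n % 8 = 6 := by
    rw [hn, show 2 * a * b * c = (2 * a) * (b * c) by ring, Nat.mul_mod, hbc8, Nat.mul_mod 2 a]; omega
  obtain ⟨D, hPr, hV⟩ := h.1 n hsq (Or.inr (Or.inl h6))
  exact two_dvd_scriptL_three_cycle_of_valuePrinted h.2.2 hsq ha hb hc hn ha8 hb8 hc8 hba hcb hac hra D hPr hV hxy hgen hx hx2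

end Summit.BirchSwinnertonDyer.PrintCf2.ThreeCycle

end
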